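import Mathlib
import Summits.RiemannHypothesis.RiemannHypothesis.Theses.SpectralTrace
import Literature.NumberTheory.LFunctions.WeilExplicit
import Literature.NumberTheory.LFunctions.RiemannSiegel

/-!
# Sketch — crux-ideate stmt-RiemannHypothesis-11195 (WindowTraceArch), ideator 3, round 1

First lemmas of three idea cards (they need not be proved here; they must elaborate).
-/

set_option linter.dupNamespace false

noncomputable section

open Complex Filter Set MeasureTheory
open scoped Real Topology

namespace Summit.RiemannHypothesis.RiemannHypothesis.Cruxes.WindowTraceArch.Ideas

open Literature.NumberTheory.LFunctions
open Summit.RiemannHypothesis.RiemannHypothesis.Theses.SpectralTrace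

/-! ## Card `gamma-pair-explicit-formula` -/

/-- The auxiliary Γ-pair `F(s) = Γ_ℝ(s) + Γ_ℝ(1-s)`, `Γ_ℝ(s) = π^{-s/2} Γ(s/2)` (Mathlib's
`Complex.Gammaℝ`). On the critical line `F(1/2+it) = 2|Γ_ℝ(1/2+it)| cos θ(t)`. -/
def gammaPairF (s : ℂ) : ℂ := Gammaℝ s + Gammaℝ (1 - s)

/-- The Gram-type chirped lattice: all real `t` with `cos θ(t) = 0`, i.e. `θ(t) ∈ π/2 + πℤ`
(both branches of `θ`, so the pair `±0.8195…` on the decreasing branch is included). -/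
def gramHalfLattice : Set ℝ := {t | Real.cos (riemannSiegelTheta t) = 0}

/-- Off-critical zeros of the Γ-pair (the "off-line divisor"; poles are at `0, 1, -2m, 2m+1`). -/
def gammaPairOffLine : Set ℂ := {ρ | gammaPairF ρ = 0 ∧ ρ.re ≠ 1 / 2}

/-- Per-strip defect: the pole pair `{2m+3, -(2m+2)}` minus the off-line zeros with real part in
`(2m+2, 2m+4]` together with their mirrors `1 - ρ` (`weilMellin g s = ∫ g(t) e^{(s-1/2)t} dt`). -/
def stripDefect (g : ℝ → ℂ) (m : ℕ) : ℂ :=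
  weilMellin g (2 * m + 3) + weilMellin g (-(2 * m + 2)) -
    ∑ᶠ ρ ∈ gammaPairOffLine ∩ {ρ | (2 * m + 2 : ℝ) < ρ.re ∧ ρ.re ≤ 2 * m + 4},
      (weilMellin g ρ + weilMellin g (1 - ρ))

/-- Bottom defect: off-line zeros with `1/2 < Re ρ ≤ 2` (no pole partner; the poles `0, 1` are the
polar term of `W`). -/
def bottomDefect (g : ℝ → ℂ) : ℂ :=
  ∑ᶠ ρ ∈ gammaPairOffLine ∩ {ρ | (1 / 2 : ℝ) < ρ.re ∧ ρ.re ≤ 2}, (weilMellin g ρ + weilMellin g (1 - ρ))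

/-- FIRST LEMMA (card A). Structural part: the critical zeros of the Γ-pair are exactly the
Gram-type lattice. -/
def GammaPairCriticalZeros : Prop :=
  ∀ t : ℝ, gammaPairF (1 / 2 + t * I) = 0 ↔ t ∈ gramHalfLattice

/-- FIRST LEMMA (card A), analytic part: the EXACT explicit formula of the Gram-type lattice on
the archimedean window — lattice sum = `W(g)` + (poles minus off-line zeros of the Γ-pair),
grouped by strips (each far pole is paired with one zero pinned super-exponentially close to it;
each strip contains finitely many off-line zeros, all simple). -/
def GammaPairExplicitFormula : Prop :=
  ∀ g : ℝ → ℂ, IsWeilTest g → tsupport g ⊆ Icc (-Real.log 2) (Real.log 2) →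
    (∀ m : ℕ, (gammaPairOffLine ∩ {ρ | (2 * m + 2 : ℝ) < ρ.re ∧ ρ.re ≤ 2 * m + 4}).Finite) ∧
    Summable (fun t : gramHalfLattice => weilMellin g (1 / 2 + ((t : ℝ) : ℂ) * I)) ∧
    Summable (stripDefect g) ∧
    ∑' t : gramHalfLattice, weilMellin g (1 / 2 + ((t : ℝ) : ℂ) * I) =
      weilFunctional g + ∑' m : ℕ, stripDefect g m - bottomDefect g

/-! ## Card `approximate-to-exact-compactness` -/

/-- Approximate window traces: a SEQUENCE of real families whose window sums converge to `W(g)`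
for every Weil test supported in `[-A, A]` (no exactness at any finite stage). -/
def ApproxWindowTrace (A : ℝ) : Prop :=
  ∃ (ι : ℕ → Type) (γ : ∀ k, ι k → ℝ), ∀ g : ℝ → ℂ, IsWeilTest g → tsupport g ⊆ Icc (-A) A →
    (∀ k, Summable fun i => weilMellin g (1 / 2 + (γ k i : ℂ) * I)) ∧
    Tendsto (fun k => ∑' i, weilMellin g (1 / 2 + (γ k i : ℂ) * I)) atTop (𝓝 (weilFunctional g))

/-- FIRST LEMMA (card B): approximate ⇒ exact inside the rung (Banach–Steinhaus on `𝒟_K`,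
positivity test `k_T = (h e^{iT·}) ⋆ (h e^{iT·})˜` for local counts, Helly selection, integrality of
vague limits of integer point measures, uniform tails from the decay of `ĝ`). -/
def ApproxToExact : Prop := ApproxWindowTrace (Real.log 2) → WindowTraceArch

/-- The target of the reduction, spelled with a sup-norm defect DENSITY (the form a construction
delivers): for every `ε > 0` and `A' < log 2` a locally finite real family whose window discrepancy
is represented on `(-log 2, log 2)` by a locally integrable function bounded by `ε` on `[-A', A']`. -/
def ApproxArch : Prop :=
  ∀ ε > 0, ∀ A' < Real.log 2, ∃ (ι : Type) (γ : ι → ℝ) (d : ℝ → ℂ),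
    LocallyIntegrableOn d (Ioo (-Real.log 2) (Real.log 2)) ∧ (∀ t ∈ Icc (-A') A', ‖d t‖ ≤ ε) ∧
    ∀ g : ℝ → ℂ, IsWeilTest g → tsupport g ⊆ Icc (-Real.log 2) (Real.log 2) →
      HasSum (fun i => weilMellin g (1 / 2 + (γ i : ℂ) * I)) (weilFunctional g + ∫ t, g t * d t)

/-- Card B, second lemma: the sup-norm form implies the sequential form. -/
def ApproxArch_to_ApproxWindowTrace : Prop := ApproxArch → ApproxWindowTrace (Real.log 2)

/-! ## Card `polya-fake-xi-base` -/

/-- Pólya's Bessel factor `H*(s) = K_{2+s/2}(2π) = (1/2) ∫ exp(-2π cosh u + (2 + s/2) u) du`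
(entire in `s`); Pólya's fake xi-function is `ξ*(s) = H*(s) + H*(1-s)`, i.e.
`Ξ*(z) = 8π² ∫₀^∞ cosh(9u/2) e^{-2π cosh 2u} cos(zu) du` up to the substitution `s = 1/2 + iz`,
`u ↦ 2u`. -/
def polyaH (s : ℂ) : ℂ :=
  (1 / 2 : ℂ) * ∫ u : ℝ, cexp (-(2 * π * Real.cosh u : ℝ) + (2 + s / 2) * u)

/-- Pólya's fake xi in the `s`-variable. -/
def polyaXiStar (s : ℂ) : ℂ := polyaH s + polyaH (1 - s)

/-- Named fact (Pólya 1926, Acta Math. 48): all zeros of `ξ*` lie on the critical line. -/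
def PolyaFakeXiRealZeros : Prop := ∀ s : ℂ, polyaXiStar s = 0 → s.re = 1 / 2

/-- FIRST LEMMA (card C): the Bessel phase `ϑ*(τ) = arg K_{9/4+iτ/2}(2π)` is strictly increasing,
`ϑ*'(τ) = Re (H*'/H*)(1/2+iτ) > 0` for all real `τ` (Hermite–Biehler property of
`z ↦ K_{9/4 - iz/2}(2π) = G(z + 9i/2)` with `G(z) = K_{iz/2}(2π)` real-rooted and even, via Pólya's
Hilfssatz / monotonicity of `|G(x+iy)|` in `|y|` for Laguerre–Pólya `G`). Consequently the zeros of
`ξ*` form a single clean chirped lattice `ϑ*(γ_n) = π(n - 1/2)` with no second branch. -/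
def PolyaPhaseMonotone : Prop :=
  ∀ τ : ℝ, 0 < (logDeriv polyaH (1 / 2 + τ * I)).re

/-- Card C, density asymptotics driving the sign claim: the Bessel phase velocity equals the
arch density plus two positive Lorentzians of unit mass (↔ `e^{-|t|/2} + e^{-5|t|/2}` on the
`t`-side, against the polar `e^{|t|/2} + e^{-|t|/2}`), up to an integrable zero-mass remainder. -/
def PolyaDensitySkeleton : Prop :=
  ∃ C : ℝ, ∀ τ : ℝ, 1 ≤ |τ| →
    |2 * (logDeriv polyaH (1 / 2 + τ * I)).re -
        ((Complex.digamma (1 / 4 + τ / 2 * I)).re - Real.log π +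
          (1 / (1 / 4 + τ / 2 * I) + 1 / (5 / 4 + τ / 2 * I)).re)| ≤ C / τ ^ 2

end Summit.RiemannHypothesis.RiemannHypothesis.Cruxes.WindowTraceArch.Ideas

end
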